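import Literature.Analysis.SpecialFunctions.BesselKHalfIntegral
import Mathlib
import HarnessLib

/-!
# Crux `UnitSpeedTwoPoint` — stub B3 `stub_besselKNegHalfLaplace` (line `yukawa_subordination`)

Crux stmt-CriticalPhenomena-17167 (`Theses.UnitLightCone.UnitSpeedTwoPoint`), line
`yukawa_subordination`, registered helper stub B3 (feeding stub B `stub_sommerfeldWeyl`): the
classical `K_{-1/2}` Laplace-type integral

  `∫₀^∞ u^{-3/2} e^{-(β/u + αu)} du = √(π/β) e^{-2√(αβ)}`   (`α ≥ 0`, `β > 0`),

with `u^{-3/2}` written as `(√u)⁻¹ u⁻¹`, together with integrability of the integrand on `(0, ∞)`.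
In the Sommerfeld–Weyl identity it is used with `α = m² ≥ 0`, `β = r²/4 > 0`.

RUNNING LOG (worker): everything below is proved; nothing is left open.

Proof.  Case `α > 0`: verbatim the tree theorem
`Literature.Analysis.SpecialFunctions.BesselKHalf.integral_inv_sqrt_mul_inv_mul_exp_neg_div_add_mul`
(Watson, *Treatise*, §6.22 (15) with §3.71 (13)).  Case `α = 0` (the massless endpoint): the
substitution `v = 1/u` (Mathlib's `integral_comp_rpow_Ioi` / `integrableOn_Ioi_comp_rpow_iff` with
exponent `-1`, Jacobian algebra `rpow_neg_two_mul_sqrt` from the tree file) turns the integral into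
the `Γ(1/2)`-integral `∫₀^∞ v^{-1/2} e^{-βv} dv = β^{-1/2} Γ(1/2) = √(π/β)`
(`Real.integral_rpow_mul_exp_neg_mul_Ioi`, `Real.Gamma_one_half_eq`, `Real.GammaIntegral_convergent`).

References: G. N. Watson, *A Treatise on the Theory of Bessel Functions*, 2nd ed. (1944), §3.71 (13),
§6.22 (15).  All steps are standard analysis [folklore].
-/

noncomputable section

open MeasureTheory Set Filter Real

namespace Summit.CriticalPhenomena.Ising3DConformalLimit.Cruxes.UnitSpeedTwoPoint.YukawaSubordination

open Literature.Analysis.SpecialFunctions.BesselKHalf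

/-- `(√x)⁻¹ = x ^ (1/2 - 1)` for `x ≥ 0`. [folklore] -/
theorem besselKNegHalfLaplace_inv_sqrt_eq_rpow {x : ℝ} (hx : 0 ≤ x) :
    (Real.sqrt x)⁻¹ = x ^ ((1 / 2 : ℝ) - 1) := by
  rw [show (1 / 2 : ℝ) - 1 = -(1 / 2) by norm_num, Real.rpow_neg hx, Real.sqrt_eq_rpow]

/-- The `Γ(1/2)`-integral: for `β > 0`, `v ↦ v^{-1/2} e^{-βv}` is integrable on `(0, ∞)` and
`∫₀^∞ v^{1/2 - 1} e^{-βv} dv = √(π/β)`. [folklore] -/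
theorem besselKNegHalfLaplace_gammaHalf {β : ℝ} (hβ : 0 < β) :
    IntegrableOn (fun v : ℝ => v ^ ((1 / 2 : ℝ) - 1) * Real.exp (-(β * v))) (Ioi 0) ∧
      ∫ v in Ioi (0 : ℝ), v ^ ((1 / 2 : ℝ) - 1) * Real.exp (-(β * v)) =
        Real.sqrt (Real.pi / β) := by
  constructor
  · -- scale the Euler integral `Γ(1/2)` by `β`
    have hG := Real.GammaIntegral_convergent (s := 1 / 2) (by norm_num)
    have h1 : IntegrableOn (fun v : ℝ => Real.exp (-(β * v)) * (β * v) ^ ((1 / 2 : ℝ) - 1))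
        (Ioi 0) := by
      have h2 := (integrableOn_Ioi_comp_mul_left_iff
        (fun x : ℝ => Real.exp (-x) * x ^ ((1 / 2 : ℝ) - 1)) 0 hβ).2
      rw [mul_zero] at h2
      exact h2 hG
    have h3 : IntegrableOn
        (fun v : ℝ => (β ^ ((1 / 2 : ℝ) - 1))⁻¹ *
          (Real.exp (-(β * v)) * (β * v) ^ ((1 / 2 : ℝ) - 1))) (Ioi 0) := h1.const_mul _
    refine h3.congr_fun (fun v hv => ?_) measurableSet_Ioi
    have hv0 : (0 : ℝ) < v := hv
    have hb : (β ^ ((1 / 2 : ℝ) - 1)) ≠ 0 := (Real.rpow_pos_of_pos hβ _).ne'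
    dsimp only
    rw [Real.mul_rpow hβ.le hv0.le]
    field_simp
  · rw [Real.integral_rpow_mul_exp_neg_mul_Ioi (by norm_num : (0 : ℝ) < 1 / 2) hβ,
      Real.Gamma_one_half_eq, ← Real.sqrt_eq_rpow, ← Real.sqrt_mul (by positivity) Real.pi]
    congr 1
    field_simp

/-- The Jacobian identity of `u = 1/v` at `α = 0`: for `x > 0`,
`|−1| x^{−2} · ((√(x⁻¹))⁻¹ (x⁻¹)⁻¹ e^{−(β (x⁻¹)⁻¹ + 0·x⁻¹)}) = x^{1/2 − 1} e^{−βx}`. [folklore] -/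
theorem besselKNegHalfLaplace_jacobian (β : ℝ) {x : ℝ} (hx : 0 < x) :
    (|(-1 : ℝ)| * x ^ ((-1 : ℝ) - 1)) •
        ((Real.sqrt (x ^ (-1 : ℝ)))⁻¹ * (x ^ (-1 : ℝ))⁻¹ *
          Real.exp (-(β * (x ^ (-1 : ℝ))⁻¹ + 0 * x ^ (-1 : ℝ)))) =
      x ^ ((1 / 2 : ℝ) - 1) * Real.exp (-(β * x)) := by
  simp only [smul_eq_mul, abs_neg, abs_one, one_mul, Real.rpow_neg_one, inv_inv, zero_mul,
    add_zero]
  rw [← mul_assoc, ← mul_assoc, rpow_neg_two_mul_sqrt hx, mul_assoc (Real.sqrt x)⁻¹,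
    inv_mul_cancel₀ hx.ne', mul_one, besselKNegHalfLaplace_inv_sqrt_eq_rpow hx.le]

/-- **The massless endpoint `α = 0`**: for `β > 0`,
`∫₀^∞ (√u)⁻¹ u⁻¹ e^{−(β/u + 0·u)} du = √(π/β) e^{−2√(0·β)} = √(π/β)`, with integrability
(substitute `u = 1/v` and use the `Γ(1/2)`-integral). [folklore] -/
theorem besselKNegHalfLaplace_massless {β : ℝ} (hβ : 0 < β) :
    IntegrableOn (fun u : ℝ => (Real.sqrt u)⁻¹ * u⁻¹ * Real.exp (-(β * u⁻¹ + 0 * u))) (Ioi 0) ∧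
      ∫ u in Ioi (0 : ℝ), (Real.sqrt u)⁻¹ * u⁻¹ * Real.exp (-(β * u⁻¹ + 0 * u)) =
        Real.sqrt (Real.pi / β) * Real.exp (-(2 * Real.sqrt (0 * β))) := by
  obtain ⟨hGint, hGval⟩ := besselKNegHalfLaplace_gammaHalf hβ
  have hpt : ∀ x ∈ Ioi (0 : ℝ),
      (|(-1 : ℝ)| * x ^ ((-1 : ℝ) - 1)) •
          (fun u : ℝ => (Real.sqrt u)⁻¹ * u⁻¹ * Real.exp (-(β * u⁻¹ + 0 * u))) (x ^ (-1 : ℝ)) =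
        x ^ ((1 / 2 : ℝ) - 1) * Real.exp (-(β * x)) := fun x hx =>
    besselKNegHalfLaplace_jacobian β hx
  constructor
  · exact (integrableOn_Ioi_comp_rpow_iff
      (fun u : ℝ => (Real.sqrt u)⁻¹ * u⁻¹ * Real.exp (-(β * u⁻¹ + 0 * u)))
      (by norm_num : (-1 : ℝ) ≠ 0)).1 (hGint.congr_fun (fun x hx => (hpt x hx).symm) measurableSet_Ioi)
  · have hR : Real.sqrt (Real.pi / β) * Real.exp (-(2 * Real.sqrt (0 * β))) =
        Real.sqrt (Real.pi / β) := by simp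
    rw [hR, ← hGval, ← integral_comp_rpow_Ioi
      (fun u : ℝ => (Real.sqrt u)⁻¹ * u⁻¹ * Real.exp (-(β * u⁻¹ + 0 * u)))
      (by norm_num : (-1 : ℝ) ≠ 0)]
    exact setIntegral_congr_fun measurableSet_Ioi hpt

/-- **Stub B3 (`stub_besselKNegHalfLaplace`).** The `K_{-1/2}` Laplace-type integral: for `α ≥ 0`
and `β > 0`, `u ↦ (√u)⁻¹ u⁻¹ e^{−(β/u + αu)}` is integrable on `(0, ∞)` and
`∫₀^∞ (√u)⁻¹ u⁻¹ e^{−(β/u + αu)} du = √(π/β) e^{−2√(αβ)}`, including the massless endpoint `α = 0`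
where it is the `Γ(1/2)`-integral. [cite: Watson1944, §6.22 (15) and §3.71 (13)] -/
theorem stub_besselKNegHalfLaplace :
    ∀ α β : ℝ, 0 ≤ α → 0 < β →
      MeasureTheory.IntegrableOn
          (fun u : ℝ => (Real.sqrt u)⁻¹ * u⁻¹ * Real.exp (-(β * u⁻¹ + α * u))) (Set.Ioi 0) ∧
        ∫ u in Set.Ioi (0 : ℝ), (Real.sqrt u)⁻¹ * u⁻¹ * Real.exp (-(β * u⁻¹ + α * u)) =
          Real.sqrt (Real.pi / β) * Real.exp (-(2 * Real.sqrt (α * β))) := by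
  intro α β hα hβ
  rcases hα.eq_or_lt with h0 | hαpos
  · subst h0
    exact besselKNegHalfLaplace_massless hβ
  · exact integral_inv_sqrt_mul_inv_mul_exp_neg_div_add_mul hαpos hβ

end Summit.CriticalPhenomena.Ising3DConformalLimit.Cruxes.UnitSpeedTwoPoint.YukawaSubordination

end
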